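import Summits.QuantumFields.YangMills.Theorems.SmallFieldWideningPlainStabAddDefs
import Summits.QuantumFields.YangMills.Theorems.SmallFieldWideningLargeFieldMassRefinementTailStubBoundedHeight
import Summits.QuantumFields.YangMills.Theorems.SmallFieldWideningLargeFieldMassRefinementTailElementaryEnvelopeProfile
import Literature.MathematicalPhysics.QuantumFieldTheory.Balaban1983to89.B10StarCount

/-!
# Route `SmallFieldWidening`, crux r4 `PlainStabAdd` (stmt-QuantumFields-27718), LINE g6-B «additive unit-stability ladder»,
# skeleton «local-split»: THE REGISTERED STUB `stub_localNewLevelTail` (M), PROVED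
# (width seat `ym-line-sfw-p2-w2` g19 for the lead `ym-line-sfw-p2` / planner `ym-idea-1` g6)

`LocalNewLevelTail` (Defs file `SmallFieldWideningPlainStabAddDefs`, byte-identical with the registered skeleton): for every block size `L`
and profile `(b₀, p₀)` (`p₀ > 2`) there are `γ₁ ∈ (0,1]`, a rate `c_τ > 0` and a power `N_τ` such that for every radius `r` there is `C_τ(r) ≥ 0`
with, for every family `F` (`F.L = L`), every `0 < γ ≤ γ₁`, every unit plaquette `q` and all `k₀ ≤ K`:
`Σ_{k₀ ≤ k < K} Gibbs_{k+1}{some finest plaquette of run k+1 in the r-column above q is θ(k+1)-large} ≤ C_τ(r)·γ^{−N_τ}·e^{−c_τ·p(√γ)²}`.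

PROOF.  (§1) The local neighbourhood `nearCol F K r q` holds at most `d²·(2r+2)^d·(L^d)^K` finest plaquettes, uniformly in the volume: the
fibres of the column map `colUp K` have exactly `(L^d)^K` sites (`B10StarCount.card_blockSet` iterated), the `ℓ¹` torus ball of radius `r`
has at most `(2r+2)^d` sites, and a plaquette is its source plus two directions.  (§2) The threshold profile grows along the ladder:
`p(g_j)² ≥ p(√γ)² + ½b₀²·j·log L·α^{2p₀−1}`, `α = 1 + ½log γ⁻¹` (`(α+x)^{2p₀} ≥ (α+x)·α^{2p₀−1}`).  (§3) Union bound: the local large-field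
event is the union of the one-plaquette events.  (§4) Each one-plaquette event of run `k+1` has Gibbs mass
`≤ C·(γL^{−(k+1)})^{−N}·e^{−c·p(g_{k+1})²}` by the tree's volume-uniform finest-level tail
(`FirstExitDeepBoundedHeight.perPlaquette_boundedHeight_uniform 0`); with `γ ≤ e^{−4(4+N)/(cb₀²)}` one has `α^{2p₀−1} ≥ α ≥ 2(4+N)/(cb₀²)`, so
the level factor `(L³)^{k+1}·(L^{k+1})^N·e^{−½cb₀²(k+1)·log L·α^{2p₀−1}} ≤ L^{−(k+1)} ≤ 2^{−(k+1)}` and the ladder sum is geometric: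
total `≤ 9(2r+2)³·C·γ^{−N}·e^{−c·p(√γ)²}` (`c_τ = c`, `N_τ = N`, `C_τ(r) = 9(2r+2)³C`).

HONEST LABEL: this is the M-sized TIGHTEN half of the line; the RG content is the other registered stub `stub_localSmallStep` (XL, open).
`PlainStabAdd`, the crux r3 `LargeFieldMassRefinementTail`, the rung R3 (`YM3TorusSU2`, a RECORD rung) and the Yang–Mills mass gap are NOT
proved by this file.

References: T. Bałaban, CMP 102 (1985) 255–275 [Balaban1985UV3] ((7) p.257, Lemma 3 p.269, (70)–(71) p.273); CMP 109 (1987) 249–301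
[Balaban1987RG1] ((0.1) p.252).
-/

noncomputable section

namespace Summit.QuantumFields.YangMills.Theorems.PlainStabAdd

open MeasureTheory
open scoped BigOperators
open Literature.MathematicalPhysics.QuantumFieldTheory.Balaban1983to89
open Literature.MathematicalPhysics.QuantumFieldTheory.Balaban1983to89.Missing
open Literature.MathematicalPhysics.QuantumFieldTheory.Balaban1983to89.T3ContinuumYM3Torus
open Literature.MathematicalPhysics.QuantumFieldTheory.Balaban1983to89.T3UnitScaleTilt
open Literature.MathematicalPhysics.QuantumFieldTheory.Balaban1983to89.T3UnitLawDensityEML (ℰp)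
open Literature.MathematicalPhysics.QuantumFieldTheory.Balaban1983to89.T3LevelShift
open Summit.QuantumFields.YangMills.Theses.SmallFieldWidening
open Summit.QuantumFields.YangMills.Theorems.LargeFieldMassRefinementTailElementaryEnvelope (pFun_coupling_eq)
open Summit.QuantumFields.YangMills.Theorems.FirstExitDeepBoundedHeight (perPlaquette_boundedHeight_uniform)

/-! ## §1 Counting the local plaquette neighbourhood -/

section Count

open Finset

variable {P : Params}

/-- The fibre count of the column map: `|{x ∈ T^{(0)} : colUp n x ∈ Λ}| = (L^d)ⁿ·|Λ|` in the standing range `n ≤ m + K`. [folklore] -/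
theorem card_filter_colUp_mem (n : ℕ) (hn : n ≤ P.m + P.K) (Λ : Finset (Site P n)) :
    (univ.filter (fun x : Site P 0 => colUp n x ∈ Λ)).card = (P.L ^ P.d) ^ n * Λ.card := by
  classical
  induction n with
  | zero => simp [colUp]
  | succ n ih =>
    have h1 : (univ.filter (fun x : Site P 0 => colUp (n + 1) x ∈ Λ)) =
        univ.filter (fun x : Site P 0 => colUp n x ∈ B10StarCount.blockSet Λ) := by
      ext x
      simp [colUp, B10StarCount.blockSet]
    rw [h1, ih (by omega) (B10StarCount.blockSet Λ), B10StarCount.card_blockSet (by omega) Λ, pow_succ]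
    ring

/-- Residues within torus distance `r` of `0` in one coordinate: at most `2r+2` of them. [folklore] -/
theorem card_filter_zmod_near_le {N : ℕ} [NeZero N] (r : ℕ) :
    (univ.filter (fun z : ZMod N => min z.val (-z).val ≤ r)).card ≤ 2 * r + 2 := by
  classical
  have hsub : univ.filter (fun z : ZMod N => min z.val (-z).val ≤ r) ⊆
      (range (r + 1)).image (fun k : ℕ => (k : ZMod N)) ∪ (range (r + 1)).image (fun k : ℕ => -(k : ZMod N)) := by
    intro z hz
    rw [mem_filter] at hz
    rw [mem_union, mem_image, mem_image]
    rcases min_le_iff.mp hz.2 with h | h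
    · exact Or.inl ⟨z.val, mem_range.mpr (by omega), ZMod.natCast_zmod_val z⟩
    · exact Or.inr ⟨(-z).val, mem_range.mpr (by omega), by rw [ZMod.natCast_zmod_val, neg_neg]⟩
  calc _ ≤ ((range (r + 1)).image (fun k : ℕ => (k : ZMod N)) ∪ (range (r + 1)).image (fun k : ℕ => -(k : ZMod N))).card :=
        card_le_card hsub
    _ ≤ ((range (r + 1)).image (fun k : ℕ => (k : ZMod N))).card + ((range (r + 1)).image (fun k : ℕ => -(k : ZMod N))).card :=
        card_union_le _ _
    _ ≤ (r + 1) + (r + 1) := add_le_add (card_image_le.trans (by simp)) (card_image_le.trans (by simp))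
    _ = 2 * r + 2 := by ring

/-- The `ℓ¹` torus ball of radius `r` has at most `(2r+2)^d` sites. [folklore] -/
theorem card_filter_tdist_le {j : ℕ} (y₀ : Site P j) (r : ℕ) :
    (univ.filter (fun y : Site P j => Site.tdist y y₀ ≤ r)).card ≤ (2 * r + 2) ^ P.d := by
  classical
  -- translate to differences and embed in a product of one-coordinate neighbourhoods
  let T : Finset (ZMod (P.sitesPerDir j)) := univ.filter (fun z => min z.val (-z).val ≤ r)
  have hT : T.card ≤ 2 * r + 2 := card_filter_zmod_near_le r
  have hinj : Set.InjOn (fun y : Site P j => (fun μ => y μ - y₀ μ)) (univ.filter (fun y : Site P j => Site.tdist y y₀ ≤ r) : Set (Site P j)) := by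
    intro y _ y' _ h
    funext μ
    have := congrFun h μ
    simpa using this
  have hmaps : ∀ y ∈ univ.filter (fun y : Site P j => Site.tdist y y₀ ≤ r),
      (fun μ => y μ - y₀ μ) ∈ Fintype.piFinset (fun _ : Fin P.d => T) := by
    intro y hy
    rw [mem_filter] at hy
    rw [Fintype.mem_piFinset]
    intro μ
    simp only [T, mem_filter, mem_univ, true_and, neg_sub]
    have hle : min (y μ - y₀ μ).val (y₀ μ - y μ).val ≤ Site.tdist y y₀ := by
      unfold Site.tdist
      exact single_le_sum (f := fun μ => min (y μ - y₀ μ).val (y₀ μ - y μ).val) (fun _ _ => Nat.zero_le _) (mem_univ μ)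
    exact hle.trans hy.2
  calc (univ.filter (fun y : Site P j => Site.tdist y y₀ ≤ r)).card
      ≤ (Fintype.piFinset (fun _ : Fin P.d => T)).card := card_le_card_of_injOn _ hmaps hinj
    _ = ∏ _μ : Fin P.d, T.card := Fintype.card_piFinset _
    _ = T.card ^ P.d := by rw [prod_const, card_univ, Fintype.card_fin]
    _ ≤ (2 * r + 2) ^ P.d := Nat.pow_le_pow_left hT _

/-- Plaquettes are determined by (source, two directions): at most `d²` plaquettes per source site. [folklore] -/
theorem card_filter_plaq_src_le {j : ℕ} (S : Finset (Site P j)) :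
    (univ.filter (fun p : Plaq P j => p.src ∈ S)).card ≤ S.card * P.d ^ 2 := by
  classical
  have hinj : Set.InjOn (fun p : Plaq P j => (p.src, p.μ, p.ν)) (univ.filter (fun p : Plaq P j => p.src ∈ S) : Set (Plaq P j)) := by
    intro p _ p' _ h
    simp only [Prod.mk.injEq] at h
    cases p; cases p'
    simp only at h
    obtain ⟨h1, h2, h3⟩ := h
    subst h1; subst h2; subst h3
    rfl
  have hmaps : ∀ p ∈ univ.filter (fun p : Plaq P j => p.src ∈ S), (p.src, p.μ, p.ν) ∈ S ×ˢ (univ : Finset (Fin P.d)) ×ˢ (univ : Finset (Fin P.d)) := by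
    intro p hp
    rw [mem_filter] at hp
    simp [hp.2]
  calc _ ≤ (S ×ˢ (univ : Finset (Fin P.d)) ×ˢ (univ : Finset (Fin P.d))).card := card_le_card_of_injOn _ hmaps hinj
    _ = S.card * P.d ^ 2 := by rw [card_product, card_product, card_univ, Fintype.card_fin]; ring

/-- **THE LOCAL PLAQUETTE COUNT**: the finest plaquettes of run `K` whose level-`K` column top is within torus distance `r` of a given
unit site number at most `d²·(2r+2)^d·(L^d)^K`, uniformly in the volume. [folklore] -/
theorem card_filter_colUp_near_le (K : ℕ) (hK : K ≤ P.m + P.K) (y₀ : Site P K) (r : ℕ) :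
    (univ.filter (fun p : Plaq P 0 => Site.tdist (colUp K p.src) y₀ ≤ r)).card ≤
      P.d ^ 2 * (2 * r + 2) ^ P.d * (P.L ^ P.d) ^ K := by
  classical
  set B : Finset (Site P K) := univ.filter (fun y : Site P K => Site.tdist y y₀ ≤ r) with hB
  set S : Finset (Site P 0) := univ.filter (fun x : Site P 0 => colUp K x ∈ B) with hS
  have h1 : univ.filter (fun p : Plaq P 0 => Site.tdist (colUp K p.src) y₀ ≤ r) = univ.filter (fun p : Plaq P 0 => p.src ∈ S) := by
    ext p; simp [hS, hB]
  rw [h1]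
  calc _ ≤ S.card * P.d ^ 2 := card_filter_plaq_src_le S
    _ = (P.L ^ P.d) ^ K * B.card * P.d ^ 2 := by rw [hS, card_filter_colUp_mem K hK B]
    _ ≤ (P.L ^ P.d) ^ K * (2 * r + 2) ^ P.d * P.d ^ 2 := by
        gcongr
        exact card_filter_tdist_le y₀ r
    _ = P.d ^ 2 * (2 * r + 2) ^ P.d * (P.L ^ P.d) ^ K := by ring

end Count

/-! ## §2 Growth of the threshold profile along the ladder -/

/-- **Growth of the profile along the cutoff ladder**: with `α = 1 − ½log γ ≥ 1` and `x = ½·j·log L ≥ 0`,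
`p(√γ)² + b₀²·x·α^{2p₀−1} ≤ p(g_j)²` (`p(g_j) = b₀(α + x)^{p₀}`, `(α+x)^{2p₀} ≥ (α+x)·α^{2p₀−1}`), for `0 < γ ≤ 1`, `p₀ ≥ 1/2`. [folklore] -/
theorem pFun_sq_growth (F : T3Family) {γ b₀ p₀ : ℝ} (hγ : 0 < γ) (hγ1 : γ ≤ 1) (hp : 1 / 2 ≤ p₀) (j : ℕ) :
    (B10.pFun b₀ p₀ (Real.sqrt γ)) ^ 2 + b₀ ^ 2 * ((j : ℝ) * Real.log F.L / 2) * (1 - Real.log γ / 2) ^ (2 * p₀ - 1) ≤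
      (B10.pFun b₀ p₀ (Real.sqrt (γ * ((F.L : ℝ)⁻¹) ^ j))) ^ 2 := by
  have hL1 : (1 : ℝ) < F.L := by exact_mod_cast F.hL.2
  have hℓ : 0 ≤ Real.log F.L := (Real.log_pos hL1).le
  have hlogγ : Real.log γ ≤ 0 := Real.log_nonpos hγ.le hγ1
  set α : ℝ := 1 - Real.log γ / 2 with hα
  have hα1 : 1 ≤ α := by rw [hα]; linarith
  have hα0 : 0 < α := by linarith
  set x : ℝ := (j : ℝ) * Real.log F.L / 2 with hx
  have hx0 : 0 ≤ x := by positivity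
  have hαx : 0 < α + x := by linarith
  have hq : 0 ≤ 2 * p₀ - 1 := by linarith
  -- the profile at the two couplings
  have h0 : B10.pFun b₀ p₀ (Real.sqrt γ) = b₀ * α ^ p₀ := by
    have h := pFun_coupling_eq F hγ b₀ p₀ 0
    simp only [Nat.cast_zero, zero_mul, zero_sub, pow_zero, mul_one] at h
    rw [h, hα]
    congr 1; congr 1; ring
  have hj : B10.pFun b₀ p₀ (Real.sqrt (γ * ((F.L : ℝ)⁻¹) ^ j)) = b₀ * (α + x) ^ p₀ := by
    rw [pFun_coupling_eq F hγ b₀ p₀ j, hα, hx]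
    congr 1; congr 1; ring
  -- squares of real powers
  have esq : ∀ {t : ℝ}, 0 ≤ t → (t ^ p₀) ^ 2 = t ^ (2 * p₀) := fun {t} ht => by
    rw [← Real.rpow_natCast (t ^ p₀) 2, ← Real.rpow_mul ht]
    push_cast
    ring_nf
  -- the key inequality `α^{2p₀} + x α^{2p₀−1} ≤ (α + x)^{2p₀}`
  have hkey : α ^ (2 * p₀) + x * α ^ (2 * p₀ - 1) ≤ (α + x) ^ (2 * p₀) := by
    have e1 : (α + x) ^ (2 * p₀) = (α + x) ^ (2 * p₀ - 1) * (α + x) := by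
      conv_lhs => rw [show 2 * p₀ = (2 * p₀ - 1) + 1 by ring]
      rw [Real.rpow_add hαx, Real.rpow_one]
    have e2 : α ^ (2 * p₀) = α ^ (2 * p₀ - 1) * α := by
      conv_lhs => rw [show 2 * p₀ = (2 * p₀ - 1) + 1 by ring]
      rw [Real.rpow_add hα0, Real.rpow_one]
    have hmono : α ^ (2 * p₀ - 1) ≤ (α + x) ^ (2 * p₀ - 1) := Real.rpow_le_rpow hα0.le (by linarith) hq
    rw [e1, e2]
    nlinarith [Real.rpow_nonneg hα0.le (2 * p₀ - 1), hmono]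
  rw [h0, hj, mul_pow, mul_pow, esq hα0.le, esq hαx.le]
  have hb : 0 ≤ b₀ ^ 2 := sq_nonneg _
  nlinarith [hkey, hb]

/-! ## §3 The union bound over the local neighbourhood -/

section UnionBound

variable {P : Params}

/-- The large-field event on a set of plaquettes is the union of the one-plaquette events. [folklore] -/
theorem setOf_not_plaqSmallOn_eq (S : Finset (Plaq P 0)) (θ : ℝ) :
    {U : GaugeField P 0 (Matrix.specialUnitaryGroup (Fin 2) ℂ) | ¬ PlaqSmallOn (↑S : Set (Plaq P 0)) θ U} =
      ⋃ p ∈ S, {U | θ ≤ GaugeGroup.dist1 (GaugeField.plaqHol U p)} := by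
  ext U
  simp only [PlaqSmallOn, Set.mem_setOf_eq, Finset.mem_coe, not_forall, not_lt, Set.mem_iUnion, exists_prop]

end UnionBound


/-! ## §4 The registered stub -/

/-- **REGISTERED STUB `stub_localNewLevelTail` of the skeleton «local-split» of crux `PlainStabAdd` (stmt-QuantumFields-27718)**: the Gibbs
masses of the local new-level LARGE-field events are summable along the ladder with a sub-Gaussian total `C_τ(r)·γ^{−N}·e^{−c·p(√γ)²}`, rate `c`
and power `N` those of the tree's volume-uniform finest-level plaquette tail (`perPlaquette_boundedHeight_uniform 0`), `C_τ(r) = 9(2r+2)³·C`,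
uniformly in the family.  Union bound over the `≤ 9(2r+2)³(L³)^{k+1}` plaquettes of `nearCol`, the per-plaquette tail
`C·(γL^{−(k+1)})^{−N}·e^{−c·p(g_{k+1})²}`, and the profile growth `p(g_{k+1})² ≥ p(√γ)² + ½b₀²(k+1)·log L·α^{2p₀−1}` with
`α = 1 + ½log γ⁻¹ ≥ 1 + 2(4+N)/(c b₀²)` for `γ ≤ e^{−4(4+N)/(cb₀²)}`, which makes the level sum geometric (ratio `≤ 1/2`).
[cite: Balaban1985UV3, (7) p.257 and Lemma 3 p.269] -/
theorem stub_localNewLevelTail : LocalNewLevelTail := by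
  intro L b₀ p₀ hb₀ hp₀
  obtain ⟨γ₁', C, c, N, hγ₁', hγ₁'1, hc, hC, htail⟩ := perPlaquette_boundedHeight_uniform 0 L b₀ p₀ hb₀ (by linarith)
  -- the precision threshold on the coupling: `α^{2p₀−1} ≥ A₀ := 2(4+N)/(c b₀²)`
  set A₀ : ℝ := 2 * (4 + (N : ℝ)) / (c * b₀ ^ 2) with hA₀
  have hA₀0 : 0 ≤ A₀ := by positivity
  refine ⟨min γ₁' (Real.exp (-(2 * A₀))), c, N, lt_min hγ₁' (Real.exp_pos _), (min_le_left _ _).trans hγ₁'1, hc,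
    fun r => ⟨9 * (2 * (r : ℝ) + 2) ^ 3 * C, by positivity, ?_⟩⟩
  intro F γ hFL hγ hγle q k₀ K
  subst hFL
  have hγ1' : γ ≤ γ₁' := hγle.trans (min_le_left _ _)
  have hγe : γ ≤ Real.exp (-(2 * A₀)) := hγle.trans (min_le_right _ _)
  have hγone : γ ≤ 1 := hγ1'.trans hγ₁'1
  have hL3 : (3 : ℝ) ≤ F.L := by
    have h3 : 3 ≤ F.L := by obtain ⟨k, hk⟩ := F.hL.1; have := F.hL.2; omega
    exact_mod_cast h3
  have hL0 : (0 : ℝ) < F.L := by linarith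
  set ℓ : ℝ := Real.log F.L with hℓ
  have hℓ2 : Real.log 2 ≤ ℓ := Real.log_le_log two_pos (by linarith)
  have hℓ0 : 0 < ℓ := lt_of_lt_of_le (Real.log_pos one_lt_two) hℓ2
  set α : ℝ := 1 - Real.log γ / 2 with hα
  have hlogγ : Real.log γ ≤ -(2 * A₀) := by
    have := Real.log_le_log hγ hγe
    rwa [Real.log_exp] at this
  have hα1 : 1 ≤ α := by rw [hα]; linarith [hA₀0]
  have hαA : A₀ ≤ α := by rw [hα]; linarith
  have hα0 : 0 < α := by linarith
  have hq1 : 1 ≤ 2 * p₀ - 1 := by linarith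
  have hαq : A₀ ≤ α ^ (2 * p₀ - 1) := by
    calc A₀ ≤ α := hαA
      _ = α ^ (1 : ℝ) := (Real.rpow_one α).symm
      _ ≤ α ^ (2 * p₀ - 1) := Real.rpow_le_rpow_of_exponent_le hα1 hq1
  -- the decay rate per level `B = ½ c b₀² ℓ α^{2p₀−1} ≥ (4 + N) ℓ`
  set B : ℝ := c * (b₀ ^ 2 * (ℓ / 2) * α ^ (2 * p₀ - 1)) with hB
  have hB4 : (4 + (N : ℝ)) * ℓ ≤ B := by
    have hcb : 0 < c * b₀ ^ 2 := by positivity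
    have h1 : 2 * (4 + (N : ℝ)) ≤ c * b₀ ^ 2 * α ^ (2 * p₀ - 1) := by
      have h := mul_le_mul_of_nonneg_left hαq hcb.le
      have e : c * b₀ ^ 2 * A₀ = 2 * (4 + (N : ℝ)) := by rw [hA₀]; field_simp
      linarith
    rw [hB]
    nlinarith [hℓ0.le]
  -- powers of `L` as exponentials
  have hLpow : ∀ M : ℕ, (F.L : ℝ) ^ M = Real.exp ((M : ℝ) * ℓ) := fun M => by
    rw [Real.exp_nat_mul, hℓ, Real.exp_log hL0]
  have hM0 : 0 ≤ 9 * (2 * (r : ℝ) + 2) ^ 3 * C * (γ⁻¹) ^ N * Real.exp (-(c * B10.pFun b₀ p₀ (Real.sqrt γ) ^ 2)) :=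
    mul_nonneg (mul_nonneg (mul_nonneg (mul_nonneg (by norm_num) (pow_nonneg (by positivity) 3)) hC)
      (pow_nonneg (inv_nonneg.mpr hγ.le) N)) (Real.exp_pos _).le
  -- the per-level bound
  have hterm : ∀ k : ℕ, (gibbsK F ℰp γ (k + 1)).real
      {U | ¬ PlaqSmallOn (nearCol F (k + 1) r q) (θBal F.L γ b₀ p₀ (k + 1)) U} ≤
      9 * (2 * (r : ℝ) + 2) ^ 3 * C * (γ⁻¹) ^ N * Real.exp (-(c * B10.pFun b₀ p₀ (Real.sqrt γ) ^ 2)) *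
        ((1 : ℝ) / 2) ^ (k + 1) := by
    intro k
    -- the local neighbourhood as a Finset, and its cardinality
    obtain ⟨S, hSdef⟩ : ∃ S : Finset (Plaq (F.P (k + 1)) 0), S = Finset.univ.filter (fun p' : Plaq (F.P (k + 1)) 0 =>
        Site.tdist (colUp (k + 1) p'.src) (plaqShift (F.sitesPerDir_unit (k + 1)) q).src ≤ r) := ⟨_, rfl⟩
    have hSset : nearCol F (k + 1) r q = (↑S : Set (Plaq (F.P (k + 1)) 0)) := by
      ext p'
      rw [hSdef]
      simp only [nearCol, Set.mem_setOf_eq, Finset.coe_filter, Finset.mem_univ, true_and]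
    have hcardN : S.card ≤ (F.P (k + 1)).d ^ 2 * (2 * r + 2) ^ (F.P (k + 1)).d * ((F.P (k + 1)).L ^ (F.P (k + 1)).d) ^ (k + 1) := by
      rw [hSdef]
      exact card_filter_colUp_near_le (P := F.P (k + 1)) (k + 1) (by change k + 1 ≤ F.m + (k + 1); omega) _ r
    have hcard : (S.card : ℝ) ≤ 9 * (2 * (r : ℝ) + 2) ^ 3 * ((F.L : ℝ) ^ 3) ^ (k + 1) := by
      have hd : (F.P (k + 1)).d = 3 := F.P_d (k + 1)
      have hLL : (F.P (k + 1)).L = F.L := rfl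
      rw [hd, hLL] at hcardN
      have h' : ((S.card : ℕ) : ℝ) ≤ ((3 ^ 2 * (2 * r + 2) ^ 3 * (F.L ^ 3) ^ (k + 1) : ℕ) : ℝ) := by exact_mod_cast hcardN
      push_cast at h'
      linarith
    -- the union bound
    have hunion : (gibbsK F ℰp γ (k + 1)).real
        {U | ¬ PlaqSmallOn (nearCol F (k + 1) r q) (θBal F.L γ b₀ p₀ (k + 1)) U} ≤
        ∑ p' ∈ S, (gibbsK F ℰp γ (k + 1)).real
          {U | θBal F.L γ b₀ p₀ (k + 1) ≤ GaugeGroup.dist1 (GaugeField.plaqHol U p')} := by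
      rw [hSset, setOf_not_plaqSmallOn_eq S]
      exact measureReal_biUnion_finset_le _ _
    -- the per-plaquette finest-level tail of run `k+1`
    have hpl : ∀ p' : Plaq (F.P (k + 1)) 0, (gibbsK F ℰp γ (k + 1)).real
        {U | θBal F.L γ b₀ p₀ (k + 1) ≤ GaugeGroup.dist1 (GaugeField.plaqHol U p')} ≤
        C * ((γ * ((F.L : ℝ)⁻¹) ^ (k + 1))⁻¹) ^ N *
          Real.exp (-(c * B10.pFun b₀ p₀ (Real.sqrt (γ * ((F.L : ℝ)⁻¹) ^ (k + 1))) ^ 2)) := by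
      intro p'
      have h := htail F γ rfl hγ hγ1' (k + 1) 0 (Nat.zero_le _) le_rfl p'
      simp only [Nat.sub_zero, Averaging.iter, id] at h
      exact h
    -- the profile growth turns the per-plaquette tail into `C γ^{-N} (L^{k+1})^N e^{-c p(√γ)²} e^{-B (k+1)}`
    have hgrow := pFun_sq_growth F (b₀ := b₀) hγ hγone (by linarith : 1 / 2 ≤ p₀) (k + 1)
    have hexp : Real.exp (-(c * B10.pFun b₀ p₀ (Real.sqrt (γ * ((F.L : ℝ)⁻¹) ^ (k + 1))) ^ 2)) ≤
        Real.exp (-(c * B10.pFun b₀ p₀ (Real.sqrt γ) ^ 2)) * Real.exp (-(B * ((k + 1 : ℕ) : ℝ))) := by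
      rw [← Real.exp_add]
      apply Real.exp_le_exp.mpr
      have e : B * ((k + 1 : ℕ) : ℝ) = c * (b₀ ^ 2 * (((k + 1 : ℕ) : ℝ) * Real.log F.L / 2) * (1 - Real.log γ / 2) ^ (2 * p₀ - 1)) := by
        rw [hB, hℓ, hα]; ring
      rw [e]
      nlinarith [hgrow, hc.le]
    have einv : ((γ * ((F.L : ℝ)⁻¹) ^ (k + 1))⁻¹) ^ N = (γ⁻¹) ^ N * ((F.L : ℝ) ^ (k + 1)) ^ N := by
      rw [mul_inv, inv_pow, inv_inv, mul_pow]
    -- the geometric factor: `(L³)^{k+1} (L^{k+1})^N e^{-B(k+1)} ≤ (1/2)^{k+1}`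
    have hgeom : ((F.L : ℝ) ^ 3) ^ (k + 1) * ((F.L : ℝ) ^ (k + 1)) ^ N * Real.exp (-(B * ((k + 1 : ℕ) : ℝ))) ≤
        ((1 : ℝ) / 2) ^ (k + 1) := by
      have e1 : ((F.L : ℝ) ^ 3) ^ (k + 1) * ((F.L : ℝ) ^ (k + 1)) ^ N = (F.L : ℝ) ^ ((3 + N) * (k + 1)) := by
        rw [← pow_mul, ← pow_mul, ← pow_add]; ring_nf
      have e2 : ((1 : ℝ) / 2) ^ (k + 1) = Real.exp (((k + 1 : ℕ) : ℝ) * (-Real.log 2)) := by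
        rw [Real.exp_nat_mul, Real.exp_neg, Real.exp_log two_pos, one_div]
      rw [e1, hLpow, e2, ← Real.exp_add]
      apply Real.exp_le_exp.mpr
      have hk0 : (0 : ℝ) ≤ ((k + 1 : ℕ) : ℝ) := Nat.cast_nonneg _
      have h1 := mul_le_mul_of_nonneg_left hB4 hk0
      have h2 := mul_le_mul_of_nonneg_left hℓ2 hk0
      push_cast at h1 h2 ⊢
      linarith [h1, h2]
    -- assemble the per-level bound
    calc (gibbsK F ℰp γ (k + 1)).real {U | ¬ PlaqSmallOn (nearCol F (k + 1) r q) (θBal F.L γ b₀ p₀ (k + 1)) U}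
        ≤ ∑ p' ∈ S, (gibbsK F ℰp γ (k + 1)).real
            {U | θBal F.L γ b₀ p₀ (k + 1) ≤ GaugeGroup.dist1 (GaugeField.plaqHol U p')} := hunion
      _ ≤ ∑ _p' ∈ S, C * ((γ * ((F.L : ℝ)⁻¹) ^ (k + 1))⁻¹) ^ N *
            Real.exp (-(c * B10.pFun b₀ p₀ (Real.sqrt (γ * ((F.L : ℝ)⁻¹) ^ (k + 1))) ^ 2)) :=
          Finset.sum_le_sum fun p' _ => hpl p'
      _ = (S.card : ℝ) * (C * ((γ⁻¹) ^ N * ((F.L : ℝ) ^ (k + 1)) ^ N) *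
            Real.exp (-(c * B10.pFun b₀ p₀ (Real.sqrt (γ * ((F.L : ℝ)⁻¹) ^ (k + 1))) ^ 2))) := by
          rw [Finset.sum_const, nsmul_eq_mul, einv]
      _ ≤ (9 * (2 * (r : ℝ) + 2) ^ 3 * ((F.L : ℝ) ^ 3) ^ (k + 1)) * (C * ((γ⁻¹) ^ N * ((F.L : ℝ) ^ (k + 1)) ^ N) *
            (Real.exp (-(c * B10.pFun b₀ p₀ (Real.sqrt γ) ^ 2)) * Real.exp (-(B * ((k + 1 : ℕ) : ℝ))))) := by
          have hCX : 0 ≤ C * ((γ⁻¹) ^ N * ((F.L : ℝ) ^ (k + 1)) ^ N) :=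
            mul_nonneg hC (mul_nonneg (pow_nonneg (inv_nonneg.mpr hγ.le) N) (pow_nonneg (pow_nonneg hL0.le _) N))
          have hcard0 : (0 : ℝ) ≤ 9 * (2 * (r : ℝ) + 2) ^ 3 * ((F.L : ℝ) ^ 3) ^ (k + 1) :=
            mul_nonneg (mul_nonneg (by norm_num) (pow_nonneg (by positivity) 3)) (pow_nonneg (pow_nonneg hL0.le 3) _)
          exact mul_le_mul hcard (mul_le_mul_of_nonneg_left hexp hCX) (mul_nonneg hCX (Real.exp_pos _).le) hcard0
      _ = 9 * (2 * (r : ℝ) + 2) ^ 3 * C * (γ⁻¹) ^ N * Real.exp (-(c * B10.pFun b₀ p₀ (Real.sqrt γ) ^ 2)) *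
            (((F.L : ℝ) ^ 3) ^ (k + 1) * ((F.L : ℝ) ^ (k + 1)) ^ N * Real.exp (-(B * ((k + 1 : ℕ) : ℝ)))) := by ring
      _ ≤ 9 * (2 * (r : ℝ) + 2) ^ 3 * C * (γ⁻¹) ^ N * Real.exp (-(c * B10.pFun b₀ p₀ (Real.sqrt γ) ^ 2)) *
            ((1 : ℝ) / 2) ^ (k + 1) :=
          mul_le_mul_of_nonneg_left hgeom hM0
  -- sum the geometric series
  have hgeo : ∑ k ∈ Finset.Ico k₀ K, ((1 : ℝ) / 2) ^ (k + 1) ≤ 1 := by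
    calc ∑ k ∈ Finset.Ico k₀ K, ((1 : ℝ) / 2) ^ (k + 1) ≤ ∑ k ∈ Finset.range K, ((1 : ℝ) / 2) ^ (k + 1) :=
          Finset.sum_le_sum_of_subset_of_nonneg (fun k hk => by
            rw [Finset.mem_Ico] at hk; exact Finset.mem_range.mpr hk.2) (fun _ _ _ => by positivity)
      _ = (1 / 2) * ∑ k ∈ Finset.range K, ((1 : ℝ) / 2) ^ k := by
          rw [Finset.mul_sum]; exact Finset.sum_congr rfl fun k _ => by rw [pow_succ]; ring
      _ ≤ (1 / 2) * 2 := by gcongr; exact sum_geometric_two_le K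
      _ = 1 := by norm_num
  calc ∑ k ∈ Finset.Ico k₀ K, (gibbsK F ℰp γ (k + 1)).real
        {U | ¬ PlaqSmallOn (nearCol F (k + 1) r q) (θBal F.L γ b₀ p₀ (k + 1)) U}
      ≤ ∑ k ∈ Finset.Ico k₀ K, 9 * (2 * (r : ℝ) + 2) ^ 3 * C * (γ⁻¹) ^ N *
          Real.exp (-(c * B10.pFun b₀ p₀ (Real.sqrt γ) ^ 2)) * ((1 : ℝ) / 2) ^ (k + 1) := Finset.sum_le_sum fun k _ => hterm k
    _ = 9 * (2 * (r : ℝ) + 2) ^ 3 * C * (γ⁻¹) ^ N * Real.exp (-(c * B10.pFun b₀ p₀ (Real.sqrt γ) ^ 2)) *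
          ∑ k ∈ Finset.Ico k₀ K, ((1 : ℝ) / 2) ^ (k + 1) := by rw [Finset.mul_sum]
    _ ≤ 9 * (2 * (r : ℝ) + 2) ^ 3 * C * (γ⁻¹) ^ N * Real.exp (-(c * B10.pFun b₀ p₀ (Real.sqrt γ) ^ 2)) * 1 :=
        mul_le_mul_of_nonneg_left hgeo hM0
    _ = _ := mul_one _

end Summit.QuantumFields.YangMills.Theorems.PlainStabAdd

end
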